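import Summits.KontsevichZagierPeriods.KontsevichZagierPeriods.Theses.FurushoPentagon
import Summits.KontsevichZagierPeriods.KontsevichZagierPeriods.Theorems.FurushoPentagonReducedPeriodRingLinStokesSymDefs
import Summits.KontsevichZagierPeriods.KontsevichZagierPeriods.Theorems.FurushoPentagonReducedPeriodRingSubdivGeneration
import Summits.KontsevichZagierPeriods.KontsevichZagierPeriods.Theorems.FurushoPentagonLinStokesSymCovDet
import Summits.KontsevichZagierPeriods.KontsevichZagierPeriods.Theorems.FurushoPentagonLinStokesSymCovHomotopy
import Summits.KontsevichZagierPeriods.KontsevichZagierPeriods.Theorems.FurushoPentagonSectorToKernelStokesSpanCalibration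
import Literature.NumberTheory.Transcendental.KZCubicalCalculus
import Literature.NumberTheory.Transcendental.KZProductIdeal
import Mathlib.LinearAlgebra.Matrix.Adjugate
import Mathlib.Analysis.Calculus.Deriv.Mul
import Mathlib.Analysis.Calculus.Deriv.Add
import Mathlib.Analysis.Calculus.Deriv.Prod
import Mathlib.Analysis.Calculus.Deriv.Pi
import Mathlib.Analysis.Calculus.Deriv.Comp

/-!
# `ReducedPeriodRing`, line `lin-stokes-sym`: closedness of the pulled-back volume form

Helper file for the stub `stub_covGeneration` of crux `FurushoPentagon.ReducedPeriodRing`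
(stmt-KontsevichZagierPeriods-3929), line `lin-stokes-sym`. With the notations of
`…LinStokesSymCovHomotopy` (`B = f(φ)·det J`, `A_j = f(φ)·det J[col j ↦ v]`, `J = (1 − y)I + yDΦ`,
`v = Φ(x) − x`, `φ = (1 − y)x + yΦ(x)`), this file proves the closedness identity
`d(φ*(f du₁ ∧ ⋯ ∧ duₙ)) = φ*(d(f du)) = 0` in coordinates:

  `∂_y B (x, y) = Σⱼ ∂ⱼ A_j (x, y)`   on `[0,1]ⁿ⁺¹` (`fderiv_volForm_eq_sum`).

Both sides are computed along coordinate slices (`hasDerivAt_volForm_snoc`,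
`hasDerivAt_faceForm_snoc_update`: product rule, chain rule, Jacobi's formula
`CovGeneration.hasDerivAt_matrix_det`); the chain-rule terms agree by Cramer's rule
`Σⱼ det J[col j ↦ v]·Df(J_j) = det J·Df(v)` (`CovGeneration.sum_det_updateCol_mul_apply_col`), the
terms `det J[col j ↦ ∂ⱼv]` are literally the terms `det J[col j ↦ ∂_yJ_j]` (`∂_y J = DΦ − I = Dv`),
and the second-derivative terms `y·det J[col j ↦ v][col k ↦ ∂ⱼ∂ₖΦ]`, `j ≠ k`, cancel in pairs by
the symmetry of mixed partials (`CovGeneration.sum_sum_erase_det_updateCol_updateCol`,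
`CovGeneration.fderiv_fderiv_apply_comm`).

References: M. Kontsevich, D. Zagier, *Periods* (2001), §1.2 rule (2); J. Ayoub, *Periods and
the conjectures of Grothendieck and Kontsevich–Zagier*, EMS Newsl. 91 (2014), Def. 10.
-/

noncomputable section

namespace Summit.KontsevichZagierPeriods.FurushoPentagon.ReducedPeriodRing.LinStokesSym

open Set MeasureTheory
open Literature.NumberTheory.Transcendental
open Literature.NumberTheory.Transcendental.KZ
open Summit.KontsevichZagierPeriods.FurushoPentagon.SectorToKernel

/-- The volume component `B(x, y) = f(φ(x,y))·det ∂ₓφ(x,y)` of the pulled-back form along the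
straight-line homotopy `φ(x, y) = (1 − y)x + yΦ(x)` on `ℝⁿ⁺¹ ∋ (x, y)` (file-local notation). -/
local notation3 (prettyPrint := false) "B[" n ", " Φ ", " f "]" => fun w : Fin (n + 1) → ℝ =>
  f (fun i : Fin n => (1 - w (Fin.last n)) * w (Fin.castSucc i) + w (Fin.last n) * Φ (Fin.init w) i) *
    (Matrix.of fun i k : Fin n => (1 - w (Fin.last n)) * (if i = k then (1 : ℝ) else 0) +
      w (Fin.last n) * fderiv ℝ (fun x => Φ x i) (Fin.init w) (Pi.single k 1)).det

/-- The face components `A_j(x, y) = f(φ(x,y))·det (∂ₓφ)[col j ↦ ∂_yφ](x,y)` of the pulled-back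
form along the straight-line homotopy (file-local notation). -/
local notation3 (prettyPrint := false) "A[" n ", " Φ ", " f "]" =>
  fun (j : Fin n) (w : Fin (n + 1) → ℝ) =>
  f (fun i : Fin n => (1 - w (Fin.last n)) * w (Fin.castSucc i) + w (Fin.last n) * Φ (Fin.init w) i) *
    ((Matrix.of fun i k : Fin n => (1 - w (Fin.last n)) * (if i = k then (1 : ℝ) else 0) +
      w (Fin.last n) * fderiv ℝ (fun x => Φ x i) (Fin.init w) (Pi.single k 1)).updateCol j
      (fun i : Fin n => Φ (Fin.init w) i - w (Fin.castSucc i))).det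

namespace CovGeneration

open SubdivGeneration (hasDerivAt_update_slice)

variable {n : ℕ} {Φ : (Fin n → ℝ) → (Fin n → ℝ)} {f : (Fin n → ℝ) → ℝ}
  {B : (Fin (n + 1) → ℝ) → ℝ} {A : Fin n → (Fin (n + 1) → ℝ) → ℝ}
  {x : Fin n → ℝ} {y : ℝ} {P : Fin n → Fin n → ℝ} {Q : Fin n → Fin n → Fin n → ℝ}
  {Jm : Matrix (Fin n) (Fin n) ℝ} {vx γ : Fin n → ℝ}

/-- A column multiplied by a scalar multiplies the determinant. [folklore] -/
theorem det_updateCol_const_mul {ι : Type*} [Fintype ι] [DecidableEq ι] (M : Matrix ι ι ℝ) (k : ι)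
    (c : ℝ) (u : ι → ℝ) : (M.updateCol k fun i => c * u i).det = c * (M.updateCol k u).det := by
  rw [← Matrix.det_updateCol_smul]
  rfl

/-- **`∂_y B` along the slice `s ↦ (x, s)`.** With `P = DΦ(x)`, `J = (1 − y)I + yP`,
`v = Φ(x) − x`, `γ = φ(x, y)`:
`∂_y B(x, y) = Df(γ)[v]·det J + f(γ)·Σ_k det J[col k ↦ (P − I)_k]`
(chain rule, product rule, Jacobi's formula with `∂_y J = P − I`). [folklore] -/
theorem hasDerivAt_volForm_snoc (hB : B = B[n, Φ, f])
    (hP : ∀ i k, P i k = fderiv ℝ (fun z => Φ z i) x (Pi.single k 1))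
    (hJ : Jm = Matrix.of fun i k : Fin n => (1 - y) * (if i = k then (1 : ℝ) else 0) + y * P i k)
    (hv : vx = fun i => Φ x i - x i) (hγ : γ = fun i => (1 - y) * x i + y * Φ x i)
    (hfd : DifferentiableAt ℝ f γ) :
    HasDerivAt (fun s => B (Fin.snoc x s))
      (fderiv ℝ f γ vx * Jm.det +
        f γ * ∑ k, (Jm.updateCol k fun i => P i k - (if i = k then (1 : ℝ) else 0)).det) y := by
  have hγ' : HasDerivAt (fun s : ℝ => fun i : Fin n => (1 - s) * x i + s * Φ x i) vx y := by
    rw [hv]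
    exact hasDerivAt_pi.2 fun i => ((((hasDerivAt_id' y).const_sub 1).mul_const (x i)).fun_add
      ((hasDerivAt_id' y).mul_const (Φ x i))).congr_deriv (by ring)
  have hF : HasDerivAt (fun s : ℝ => f (fun i : Fin n => (1 - s) * x i + s * Φ x i))
      (fderiv ℝ f γ vx) y := by
    rw [hγ] at hfd ⊢
    exact hfd.hasFDerivAt.comp_hasDerivAt y hγ'
  have hJ' : HasDerivAt (fun s : ℝ => (Matrix.of fun i k : Fin n =>
      (1 - s) * (if i = k then (1 : ℝ) else 0) + s * P i k).det)
      (∑ k, (Jm.updateCol k fun i => P i k - (if i = k then (1 : ℝ) else 0)).det) y := by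
    have h := hasDerivAt_matrix_det (t := y)
      (A := fun s => Matrix.of fun i k : Fin n => (1 - s) * (if i = k then (1 : ℝ) else 0) + s * P i k)
      (A' := Matrix.of fun i k : Fin n => P i k - (if i = k then (1 : ℝ) else 0)) fun i k => by
        simp only [Matrix.of_apply]
        exact ((((hasDerivAt_id' y).const_sub 1).mul_const _).fun_add
          ((hasDerivAt_id' y).mul_const (P i k))).congr_deriv (by ring)
    rw [hJ]
    simpa only [Matrix.of_apply] using h
  have hfun : (fun s => B (Fin.snoc x s)) = fun s => f (fun i : Fin n => (1 - s) * x i + s * Φ x i) *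
      (Matrix.of fun i k : Fin n => (1 - s) * (if i = k then (1 : ℝ) else 0) + s * P i k).det := by
    funext s
    rw [volForm_snoc hB]
    simp only [hP]
  rw [hfun]
  refine (hF.fun_mul hJ').congr_deriv ?_
  rw [hJ, hγ]

/-- **`∂ⱼ A_j` along the transposed slice `s ↦ ((x with x_j ↦ s), y)`.** With the notations of
`hasDerivAt_volForm_snoc` and `Q i k l = ∂_l ∂_k Φ_i (x)`:
`∂ⱼ A_j(x, y) = Df(γ)[J_j]·det J[col j ↦ v] + f(γ)·(det J[col j ↦ (P − I)_j]
  + y·Σ_{k ≠ j} det J[col j ↦ v][col k ↦ Q_{·kj}])`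
(chain rule with `∂ⱼφ = J_j`, Jacobi's formula with `∂ⱼ v = (P − I)_j`, `∂ⱼ J_k = y Q_{·kj}`).
[folklore] -/
theorem hasDerivAt_faceForm_snoc_update (hA : A = A[n, Φ, f]) (j : Fin n)
    (hP : ∀ i k, P i k = fderiv ℝ (fun z => Φ z i) x (Pi.single k 1))
    (hQ : ∀ i k l, Q i k l =
      fderiv ℝ (fun z => fderiv ℝ (fun z' => Φ z' i) z (Pi.single k 1)) x (Pi.single l 1))
    (hJ : Jm = Matrix.of fun i k : Fin n => (1 - y) * (if i = k then (1 : ℝ) else 0) + y * P i k)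
    (hv : vx = fun i => Φ x i - x i) (hγ : γ = fun i => (1 - y) * x i + y * Φ x i)
    (hfd : DifferentiableAt ℝ f γ) (hΦd : ∀ i, DifferentiableAt ℝ (fun z => Φ z i) x)
    (hPd : ∀ i k, DifferentiableAt ℝ (fun z => fderiv ℝ (fun z' => Φ z' i) z (Pi.single k 1)) x) :
    HasDerivAt (fun s => A j (Fin.snoc (Function.update x j s) y))
      (fderiv ℝ f γ (fun i => Jm i j) * (Jm.updateCol j vx).det +
        f γ * ((Jm.updateCol j fun i => P i j - (if i = j then (1 : ℝ) else 0)).det +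
          y * ∑ k ∈ Finset.univ.erase j, ((Jm.updateCol j vx).updateCol k fun i => Q i k j).det))
      (x j) := by
  -- elementary slices through `x` in the direction `j`
  have hu : ∀ i, HasDerivAt (fun s => Function.update x j s i) (if i = j then (1 : ℝ) else 0) (x j) :=
    fun i => by simpa [Pi.single_apply] using hasDerivAt_pi.1 (hasDerivAt_update x j (x j)) i
  have hΦu : ∀ i, HasDerivAt (fun s => Φ (Function.update x j s) i) (P i j) (x j) := fun i => by
    have hd : DifferentiableAt ℝ (fun z => Φ z i) (Function.update x j (x j)) := by
      rw [Function.update_eq_self]; exact hΦd i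
    have h := hasDerivAt_update_slice hd
    rw [Function.update_eq_self, ← hP] at h
    exact h
  have hPu : ∀ i k, HasDerivAt
      (fun s => fderiv ℝ (fun z' => Φ z' i) (Function.update x j s) (Pi.single k 1)) (Q i k j) (x j) :=
    fun i k => by
    have hd : DifferentiableAt ℝ (fun z => fderiv ℝ (fun z' => Φ z' i) z (Pi.single k 1))
        (Function.update x j (x j)) := by
      rw [Function.update_eq_self]; exact hPd i k
    have h := hasDerivAt_update_slice hd
    rw [Function.update_eq_self, ← hQ] at h
    exact h
  -- the path `s ↦ φ((x with x_j ↦ s), y)` has velocity `J_j`; `F = f ∘ path`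
  have hpath : HasDerivAt (fun s : ℝ => fun i : Fin n =>
      (1 - y) * Function.update x j s i + y * Φ (Function.update x j s) i) (fun i => Jm i j) (x j) := by
    refine hasDerivAt_pi.2 fun i =>
      (((hu i).const_mul (1 - y)).fun_add ((hΦu i).const_mul y)).congr_deriv ?_
    rw [hJ, Matrix.of_apply]
  have hpath0 : (fun i : Fin n => (1 - y) * Function.update x j (x j) i +
      y * Φ (Function.update x j (x j)) i) = γ := by
    rw [Function.update_eq_self, hγ]
  have hF : HasDerivAt (fun s : ℝ => f (fun i : Fin n =>
      (1 - y) * Function.update x j s i + y * Φ (Function.update x j s) i))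
      (fderiv ℝ f γ (fun i => Jm i j)) (x j) := by
    have hfd' : DifferentiableAt ℝ f (fun i : Fin n => (1 - y) * Function.update x j (x j) i +
        y * Φ (Function.update x j (x j)) i) := by
      rw [hpath0]; exact hfd
    have h := hfd'.hasFDerivAt.comp_hasDerivAt (x j) hpath
    rw [hpath0] at h
    exact h
  -- the matrix `K(s) = J[col j ↦ v]((x with x_j ↦ s), y)` (Jacobi's formula, split at `k = j`)
  have hA0 : (Matrix.of fun i k : Fin n => (1 - y) * (if i = k then (1 : ℝ) else 0) +
        y * fderiv ℝ (fun z' => Φ z' i) (Function.update x j (x j)) (Pi.single k 1)).updateCol j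
      (fun i => Φ (Function.update x j (x j)) i - Function.update x j (x j) i) =
      Jm.updateCol j vx := by
    rw [Function.update_eq_self, hJ, hv]
    simp only [hP]
  have hK : HasDerivAt (fun s : ℝ => ((Matrix.of fun i k : Fin n =>
      (1 - y) * (if i = k then (1 : ℝ) else 0) +
        y * fderiv ℝ (fun z' => Φ z' i) (Function.update x j s) (Pi.single k 1)).updateCol j
      (fun i => Φ (Function.update x j s) i - Function.update x j s i)).det)
      ((Jm.updateCol j fun i => P i j - (if i = j then (1 : ℝ) else 0)).det +
        y * ∑ k ∈ Finset.univ.erase j, ((Jm.updateCol j vx).updateCol k fun i => Q i k j).det)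
      (x j) := by
    have h := hasDerivAt_matrix_det (t := x j)
      (A := fun s : ℝ => (Matrix.of fun i k : Fin n =>
        (1 - y) * (if i = k then (1 : ℝ) else 0) +
          y * fderiv ℝ (fun z' => Φ z' i) (Function.update x j s) (Pi.single k 1)).updateCol j
        (fun i => Φ (Function.update x j s) i - Function.update x j s i))
      (A' := Matrix.of fun i k : Fin n =>
        if k = j then P i j - (if i = j then (1 : ℝ) else 0) else y * Q i k j)
      fun i k => by
        simp only [Matrix.updateCol_apply, Matrix.of_apply]
        by_cases hk : k = j
        · simp only [hk, if_true]
          exact (hΦu i).fun_sub (hu i)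
        · simp only [hk, if_false]
          exact ((hPu i k).const_mul y).const_add _
    refine h.congr_deriv ?_
    rw [hA0, sum_eq_add_sum_erase _ j]
    simp only [Matrix.of_apply, if_true, Matrix.updateCol_idem]
    congr 1
    rw [Finset.mul_sum]
    refine Finset.sum_congr rfl fun k hk => ?_
    simp only [Finset.ne_of_mem_erase hk, if_false]
    exact det_updateCol_const_mul _ k y _
  have hfun : (fun s => A j (Fin.snoc (Function.update x j s) y)) = fun s =>
      f (fun i : Fin n => (1 - y) * Function.update x j s i + y * Φ (Function.update x j s) i) *
      ((Matrix.of fun i k : Fin n => (1 - y) * (if i = k then (1 : ℝ) else 0) +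
          y * fderiv ℝ (fun z' => Φ z' i) (Function.update x j s) (Pi.single k 1)).updateCol j
        (fun i => Φ (Function.update x j s) i - Function.update x j s i)).det :=
    funext fun s => faceForm_snoc hA j _ y
  rw [hfun]
  refine (hF.fun_mul hK).congr_deriv ?_
  rw [hA0, hpath0]

/-- **Closedness of the pulled-back volume form: `∂_y B = Σⱼ ∂ⱼ A_j` on `[0,1]ⁿ⁺¹`.** For `Φ`
with coordinates analytic near the cube mapping the cube into itself and `f` analytic near the
cube: the chain-rule terms agree by Cramer's rule, the terms `det J[col j ↦ ∂ⱼ v]` are the terms of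
`∂_y det J`, and the second-derivative terms cancel in pairs by symmetry of mixed partials.
[Kontsevich–Zagier 2001, §1.2 rule (2); folklore] -/
theorem fderiv_volForm_eq_sum (hB : B = B[n, Φ, f]) (hA : A = A[n, Φ, f])
    (hΦa : ∀ i, AnalyticOnNhd ℝ (fun x => Φ x i) (cube n)) (hΦm : MapsTo Φ (cube n) (cube n))
    (hfa : AnalyticOnNhd ℝ f (cube n)) (hBa : AnalyticOnNhd ℝ B (cube (n + 1)))
    (hAa : ∀ j, AnalyticOnNhd ℝ (A j) (cube (n + 1))) (hx : x ∈ cube n) (hy : y ∈ Icc (0 : ℝ) 1) :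
    fderiv ℝ B (Fin.snoc x y) (Pi.single (Fin.last n) 1) =
      ∑ j, fderiv ℝ (A j) (Fin.snoc x y) (Pi.single (Fin.castSucc j) 1) := by
  obtain ⟨P, hP⟩ : ∃ P : Fin n → Fin n → ℝ,
      ∀ i k, P i k = fderiv ℝ (fun z => Φ z i) x (Pi.single k 1) := ⟨_, fun _ _ => rfl⟩
  obtain ⟨Q, hQ⟩ : ∃ Q : Fin n → Fin n → Fin n → ℝ, ∀ i k l, Q i k l =
      fderiv ℝ (fun z => fderiv ℝ (fun z' => Φ z' i) z (Pi.single k 1)) x (Pi.single l 1) :=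
    ⟨_, fun _ _ _ => rfl⟩
  obtain ⟨Jm, hJ⟩ : ∃ Jm : Matrix (Fin n) (Fin n) ℝ, Jm = Matrix.of fun i k : Fin n =>
      (1 - y) * (if i = k then (1 : ℝ) else 0) + y * P i k := ⟨_, rfl⟩
  obtain ⟨vx, hv⟩ : ∃ vx : Fin n → ℝ, vx = fun i => Φ x i - x i := ⟨_, rfl⟩
  obtain ⟨γ, hγ⟩ : ∃ γ : Fin n → ℝ, γ = fun i => (1 - y) * x i + y * Φ x i := ⟨_, rfl⟩
  have hγmem : γ ∈ cube n := by
    rw [hγ]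
    intro i
    have hΦ := hΦm hx i
    have hxi := hx i
    constructor <;> nlinarith [hΦ.1, hΦ.2, hxi.1, hxi.2, hy.1, hy.2]
  have hfd : DifferentiableAt ℝ f γ := (hfa γ hγmem).differentiableAt
  have hΦd : ∀ i, DifferentiableAt ℝ (fun z => Φ z i) x := fun i => (hΦa i x hx).differentiableAt
  have hPd : ∀ i k, DifferentiableAt ℝ (fun z => fderiv ℝ (fun z' => Φ z' i) z (Pi.single k 1)) x :=
    fun i k => (stokesCal_analyticOnNhd_fderiv_apply (hΦa i) (Pi.single k 1) x hx).differentiableAt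
  have hw : (Fin.snoc x y : Fin (n + 1) → ℝ) ∈ cube (n + 1) := snoc_mem_cube_iff.2 ⟨hx, hy.1, hy.2⟩
  -- the left-hand side
  have h1 := hasDerivAt_volForm_snoc hB hP hJ hv hγ hfd
  rw [(stokesCal_hasDerivAt_snoc (hBa _ hw).differentiableAt).unique h1]
  -- the right-hand side, termwise
  have h2 : ∀ j, fderiv ℝ (A j) (Fin.snoc x y) (Pi.single (Fin.castSucc j) 1) =
      fderiv ℝ f γ (fun i => Jm i j) * (Jm.updateCol j vx).det +
        f γ * ((Jm.updateCol j fun i => P i j - (if i = j then (1 : ℝ) else 0)).det +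
          y * ∑ k ∈ Finset.univ.erase j, ((Jm.updateCol j vx).updateCol k fun i => Q i k j).det) := by
    intro j
    have hd : DifferentiableAt ℝ (A j) (Function.update (Fin.snoc x y) (Fin.castSucc j) (x j)) := by
      rw [← Fin.snoc_update, Function.update_eq_self]
      exact (hAa j _ hw).differentiableAt
    have hb := hasDerivAt_update_slice hd
    simp only [← Fin.snoc_update, Function.update_eq_self] at hb
    exact hb.unique (hasDerivAt_faceForm_snoc_update hA j hP hQ hJ hv hγ hfd hΦd hPd)
  simp only [h2]
  -- the algebra
  have hC : ∑ j, fderiv ℝ f γ (fun i => Jm i j) * (Jm.updateCol j vx).det =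
      fderiv ℝ f γ vx * Jm.det := by
    rw [mul_comm, ← sum_det_updateCol_mul_apply_col Jm vx (fderiv ℝ f γ)]
    exact Finset.sum_congr rfl fun j _ => mul_comm _ _
  have hS : ∑ j, ∑ k ∈ Finset.univ.erase j, ((Jm.updateCol j vx).updateCol k fun i => Q i k j).det = 0 :=
    sum_sum_erase_det_updateCol_updateCol Jm vx (fun j k => fun i => Q i k j) fun j k =>
      funext fun i => by
        rw [hQ, hQ]
        exact fderiv_fderiv_apply_comm (hΦa i x hx) _ _
  rw [Finset.sum_add_distrib, hC]
  congr 1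
  rw [← Finset.mul_sum]
  congr 1
  rw [Finset.sum_add_distrib, ← Finset.mul_sum, hS, mul_zero, add_zero]

/-- Anchor of this helper file (registered sub-goal `stub_covGeneration_closed` of crux
stmt-KontsevichZagierPeriods-3929, serving `stub_covGeneration` of line `lin-stokes-sym`): the
closedness identity `∂_y B = Σⱼ ∂ⱼ A_j` on `[0,1]ⁿ⁺¹` for the explicit forms `B`, `A_j` of the
straight-line homotopy (`fderiv_volForm_eq_sum` with `sideConditions`).
[Kontsevich–Zagier 2001, §1.2 rule (2); folklore] -/
theorem stub_covGeneration_closed : ∀ (n : ℕ) (Φ : (Fin n → ℝ) → (Fin n → ℝ)) (f : (Fin n → ℝ) → ℝ), (∀ i, AnalyticOnNhd ℝ (fun x => Φ x i) (KZ.cube n)) → (∀ i, IsSemialgebraicFunOn ℚ (KZ.cube n) (fun x => Φ x i)) → Set.MapsTo Φ (KZ.cube n) (KZ.cube n) → AnalyticOnNhd ℝ f (KZ.cube n) → IsSemialgebraicFunOn ℚ (KZ.cube n) f → ∀ x ∈ KZ.cube n, ∀ y ∈ Set.Icc (0 : ℝ) 1, fderiv ℝ (fun w : Fin (n + 1) →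 ℝ => f (fun i : Fin n => (1 - w (Fin.last n)) * w (Fin.castSucc i) + w (Fin.last n) * Φ (Fin.init w) i) * (Matrix.of fun i k : Fin n => (1 - w (Fin.last n)) * (if i = k then (1 : ℝ) else 0) + w (Fin.last n) * fderiv ℝ (fun z => Φ z i) (Fin.init w) (Pi.single k 1)).det) (Fin.snoc x y) (Pi.single (Fin.last n) 1) = ∑ j : Fin n, fderiv ℝ ((fun (j : Fin n) (w : Fin (n + 1) → ℝ) => f (fun i : Fin n => (1 - w (Fin.last n)) * w (Fin.castSucc i) + w (Fin.last n) * Φ (Fin.init w) i) * ((Matrix.of fun i k : Fin n => (1 - w (Fin.last n)) * (if i = k then (1 : ℝ) else 0) + w (Fin.last n) * fderiv ℝ (fun z => Φ z i) (Fin.init w) (Pi.single k 1)).updateCol j (fun i : Fin n => Φ (Fin.init w) i - w (Fin.castSucc i))).det) j) (Fin.snoc x y) (Pi.single (Fin.castSucc j) 1) :=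
  fun n Φ f hΦa hΦs hΦm hfa hfs x hx y hy => by
    obtain ⟨⟨hBa, -⟩, hAas⟩ := sideConditions (B := B[n, Φ, f]) (A := A[n, Φ, f]) hΦa hΦs hΦm hfa
      hfs rfl rfl
    exact fderiv_volForm_eq_sum (B := B[n, Φ, f]) (A := A[n, Φ, f]) rfl rfl hΦa hΦm hfa hBa
      (fun j => (hAas j).1) hx hy

end CovGeneration

end Summit.KontsevichZagierPeriods.FurushoPentagon.ReducedPeriodRing.LinStokesSym
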